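import Mathlib
import Summits.ValiantsHypothesis.ValiantsHypothesis.Theses.ValuativeGCT
import Summits.ValiantsHypothesis.ValiantsHypothesis.Theorems.ValuativeGCTValuativeFlipEvenDegreeBite
import Summits.ValiantsHypothesis.ValiantsHypothesis.Theorems.ValuativeGCTValuativeFlipOrderExtraction
import Summits.ValiantsHypothesis.ValiantsHypothesis.Theorems.ValuativeGCTValuativeFlipLineRestriction

/-!
# `ValuativeGCT.ValuativeFlip` (stmt-ValiantsHypothesis-12624), det census — THE CUT BITES IN EVERY ODD DEGREE
# `δ ≥ 3`, HENCE IN EVERY DEGREE `δ ≥ 2`, AT EVERY `m ≥ 3`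

Wall-breaker axis "det-orbit-closure multiplicity bounds for the det census".  In odd degree an order-`0` witness is
impossible along a τ-stable singular centre (parity law), but an ORDER-ONE witness suffices at the crux's threshold
`δ (m - r) = δ ≥ 3`: the product `H = G_T ^ k · G₁` of the first-rung witness `G_T` (degree `m · 2`, non-zero at the
sparse point `p` of `L_U`) with the level-1 blow-up `G₁ = 2 det X_{j₅}` of a FIFTH row slot (degree `m · 1`) has degree
`m · (2k+1)` and vanishes on `L_U` to order exactly `1` at `p`, when the fifth row of `p` is the rank-`(m-1)` matrix
`s_P ⊕ Y ∈ U`: restricting to the line `p + s · E` (`E` = the unit matrix `E₂₂` in the fifth slot) is the algebra map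
`ψ : X_v ↦ C (p v) + C (E v) · s` into `ℂ[s]`, which maps `I(L_U)` into `(s)` (`frl_X_dvd_of_mem_vanishingIdeal`), hence
`I(L_U)^2` into `(s²)`; but `ψ(H) = C(G_T(p)^k) · 2 · (s · C(det Y))`, whose `s¹`-coefficient `2 det Y · G_T(p)^k` is non-zero
(`det (s_P + s E₂₂) = s`, `frl_det_sP_add`).  So `H ∉ I(L_U)^2 ⊇ I(L_U)^t` for every `t ≥ 2`; the order-`t` extraction
`hwExtraction_notMem_pow` and the jet criterion `finrank_trunc_lt_of_notMem_pow` give the strict drop.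

* `oddDegree_bite_of_mem` — general centre (triangle + invertible block): for every `k`, some `λ ⊢ m (2k+1)` has
  `finrank T_U(t, λ*) < finrank T_U(0, λ*)` for every `t ≥ 2`;
* the crux-currency packaging (admissible corner centre, threshold `(2k+1)(m-r)`; every degree `δ ≥ 2`) is the
  companion file `ValuativeGCTValuativeFlipAllDegreesBite`.

References: BLMW, SIAM J. Comput. 40 (2011) §5.2; M. Domokos, A. N. Zubkov, Transform. Groups 6 (2001) Thm. 1.1.
-/

namespace Summit.ValiantsHypothesis.ValiantsHypothesis.Theorems.ValuativeFlip

open Literature.NumberTheory.DiophantineGeometry Literature.Computability.AlgebraicComplexity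
open MvPolynomial
open scoped BigOperators Matrix Kronecker Polynomial

-- `Summit.ValiantsHypothesis.ValiantsHypothesis.…` is the tree's mandated single-conjunct layout (Sub = Summit).
set_option linter.dupNamespace false

noncomputable section

/-! ### §3 The odd-degree bite -/

/-- **The cut bites in every odd degree `2k+1` at every threshold `t ≥ 2`.**  For any placement `e : Fin 3 ⊕ κ ≃ Fin m` and
any centre `U` containing the skew triangle and a block `0₃ ⊕ Y` (`det Y ≠ 0`), and every `k`, some `λ ⊢ m (2k+1)` (`≤ m²`
parts) has `finrank T_U(t, λ*) < finrank T_U(0, λ*)` for every `t ≥ 2` (truncation in degree `m (2k+1)`).  Witness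
`H = G_T^k · G₁`, `G₁` the τ-symmetrised level-1 blow-up of a fifth row slot carrying the rank-`(m-1)` matrix `s_P ⊕ Y ∈ U`;
`H ∉ I(L_U)^2` by the line restriction of §1–§2; order-`2` extraction `hwExtraction_notMem_pow`. [folklore] -/
theorem oddDegree_bite_of_mem {m : ℕ} {κ : Type*} [Fintype κ] [DecidableEq κ] (e : Fin 3 ⊕ κ ≃ Fin m)
    (Y : Matrix κ κ ℂ) (hY : Y.det ≠ 0) (U : Submodule ℂ (MatIdx m → ℂ))
    (hP : (fun i : MatIdx m => Matrix.reindex e e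
        (Matrix.fromBlocks (!![0, 1, 0; -1, 0, 0; 0, 0, 0] : Matrix (Fin 3) (Fin 3) ℂ) 0 0 (0 : Matrix κ κ ℂ))
        (ofLex i).1 (ofLex i).2) ∈ U)
    (hQ : (fun i : MatIdx m => Matrix.reindex e e
        (Matrix.fromBlocks (!![0, 0, 1; 0, 0, 0; -1, 0, 0] : Matrix (Fin 3) (Fin 3) ℂ) 0 0 (0 : Matrix κ κ ℂ))
        (ofLex i).1 (ofLex i).2) ∈ U)
    (hR : (fun i : MatIdx m => Matrix.reindex e e
        (Matrix.fromBlocks (!![0, 0, 0; 0, 0, 1; 0, -1, 0] : Matrix (Fin 3) (Fin 3) ℂ) 0 0 (0 : Matrix κ κ ℂ))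
        (ofLex i).1 (ofLex i).2) ∈ U)
    (hYU : (fun i : MatIdx m => Matrix.reindex e e
        (Matrix.fromBlocks (0 : Matrix (Fin 3) (Fin 3) ℂ) 0 0 Y) (ofLex i).1 (ofLex i).2) ∈ U)
    (k : ℕ) :
    ∃ lam : Nat.Partition (m * (2 * k + 1)), lam.parts.card ≤ m * m ∧ ∀ t : ℕ, 2 ≤ t →
      Module.finrank ℂ ↥(MvPolynomial.homogeneousSubmodule (MatIdx m × MatIdx m) ℂ (m * (2 * k + 1))
        ⊓ ((MvPolynomial.vanishingIdeal ℂ {p : MatIdx m × MatIdx m → ℂ |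
              ∀ j : MatIdx m, (fun i => p (j, i)) ∈ U}) ^ t).restrictScalars ℂ
        ⊓ (⨅ (M : Matrix (MatIdx m) (MatIdx m) ℂ)
            (_ : linSubst (MatIdx m) ℂ M (detFormLex ℂ m) = detFormLex ℂ m),
            LinearMap.ker ((MvPolynomial.aeval (R := ℂ) fun p : MatIdx m × MatIdx m =>
              ∑ l : MatIdx m, M l p.2 • MvPolynomial.X (p.1, l)).toLinearMap
              - LinearMap.id (R := ℂ) (M := MvPolynomial (MatIdx m × MatIdx m) ℂ)))
        ⊓ (⨅ (g : Matrix.GeneralLinearGroup (MatIdx m) ℂ) (_ : IsUpperTriangular g),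
            LinearMap.ker ((MvPolynomial.aeval (R := ℂ) fun p : MatIdx m × MatIdx m =>
              ∑ l : MatIdx m, ((g⁻¹ : Matrix.GeneralLinearGroup (MatIdx m) ℂ) :
                Matrix (MatIdx m) (MatIdx m) ℂ) p.1 l • MvPolynomial.X (l, p.2)).toLinearMap
              - weightChar ((Weight.dualOfPartition (m * m) lam).toMatIdx) g •
                LinearMap.id (R := ℂ) (M := MvPolynomial (MatIdx m × MatIdx m) ℂ))))
      < Module.finrank ℂ ↥(MvPolynomial.homogeneousSubmodule (MatIdx m × MatIdx m) ℂ (m * (2 * k + 1))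
        ⊓ ((MvPolynomial.vanishingIdeal ℂ {p : MatIdx m × MatIdx m → ℂ |
              ∀ j : MatIdx m, (fun i => p (j, i)) ∈ U}) ^ 0).restrictScalars ℂ
        ⊓ (⨅ (M : Matrix (MatIdx m) (MatIdx m) ℂ)
            (_ : linSubst (MatIdx m) ℂ M (detFormLex ℂ m) = detFormLex ℂ m),
            LinearMap.ker ((MvPolynomial.aeval (R := ℂ) fun p : MatIdx m × MatIdx m =>
              ∑ l : MatIdx m, M l p.2 • MvPolynomial.X (p.1, l)).toLinearMap
              - LinearMap.id (R := ℂ) (M := MvPolynomial (MatIdx m × MatIdx m) ℂ)))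
        ⊓ (⨅ (g : Matrix.GeneralLinearGroup (MatIdx m) ℂ) (_ : IsUpperTriangular g),
            LinearMap.ker ((MvPolynomial.aeval (R := ℂ) fun p : MatIdx m × MatIdx m =>
              ∑ l : MatIdx m, ((g⁻¹ : Matrix.GeneralLinearGroup (MatIdx m) ℂ) :
                Matrix (MatIdx m) (MatIdx m) ℂ) p.1 l • MvPolynomial.X (l, p.2)).toLinearMap
              - weightChar ((Weight.dualOfPartition (m * m) lam).toMatIdx) g •
                LinearMap.id (R := ℂ) (M := MvPolynomial (MatIdx m × MatIdx m) ℂ)))) := by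
  classical
  -- the three letters and the four row slots
  set c : Fin 3 → Fin m := fun i => e (Sum.inl i) with hc
  have hcinj : Function.Injective c := fun i j h => Sum.inl_injective (e.injective h)
  set jP : MatIdx m := toLex (c 0, c 1) with hjP
  set jQ : MatIdx m := toLex (c 0, c 2) with hjQ
  set jR : MatIdx m := toLex (c 1, c 2) with hjR
  set jY : MatIdx m := toLex (c 0, c 0) with hjY
  set j5 : MatIdx m := toLex (c 1, c 1) with hj5
  have hne : ∀ {a b a' b' : Fin 3}, (a, b) ≠ (a', b') → (toLex (c a, c b) : MatIdx m) ≠ toLex (c a', c b') := by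
    intro a b a' b' h h'
    apply h
    have h'' := toLex.injective h'
    simp only [Prod.mk.injEq] at h'' ⊢
    exact ⟨hcinj h''.1, hcinj h''.2⟩
  have hPQ : jP ≠ jQ := hne (by decide)
  have hPR : jP ≠ jR := hne (by decide)
  have hPY : jP ≠ jY := hne (by decide)
  have hQR : jQ ≠ jR := hne (by decide)
  have hQY : jQ ≠ jY := hne (by decide)
  have hRY : jR ≠ jY := hne (by decide)
  have h5P : j5 ≠ jP := hne (by decide)
  have h5Q : j5 ≠ jQ := hne (by decide)
  have h5R : j5 ≠ jR := hne (by decide)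
  have h5Y : j5 ≠ jY := hne (by decide)
  -- the four row matrices
  set MP : Matrix (Fin m) (Fin m) ℂ := Matrix.reindex e e
    (Matrix.fromBlocks (!![0, 1, 0; -1, 0, 0; 0, 0, 0] : Matrix (Fin 3) (Fin 3) ℂ) 0 0 (0 : Matrix κ κ ℂ)) with hMP
  set MQ : Matrix (Fin m) (Fin m) ℂ := Matrix.reindex e e
    (Matrix.fromBlocks (!![0, 0, 1; 0, 0, 0; -1, 0, 0] : Matrix (Fin 3) (Fin 3) ℂ) 0 0 (0 : Matrix κ κ ℂ)) with hMQ
  set MR : Matrix (Fin m) (Fin m) ℂ := Matrix.reindex e e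
    (Matrix.fromBlocks (!![0, 0, 0; 0, 0, 1; 0, -1, 0] : Matrix (Fin 3) (Fin 3) ℂ) 0 0 (0 : Matrix κ κ ℂ)) with hMR
  set MY : Matrix (Fin m) (Fin m) ℂ := Matrix.reindex e e
    (Matrix.fromBlocks (0 : Matrix (Fin 3) (Fin 3) ℂ) 0 0 Y) with hMY
  -- blow-up data and the point
  set σx : Matrix (Fin 2) (Fin 2) ℂ := !![0, 1; 1, 0] with hσx
  set σz : Matrix (Fin 2) (Fin 2) ℂ := !![1, 0; 0, -1] with hσz
  set T : MatIdx m → Matrix (Fin 2) (Fin 2) ℂ := fun j =>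
    if j = jP then 1 else if j = jQ then σx else if j = jR then σz else if j = jY then 1 else 0 with hT
  set S : MatIdx m → Matrix (Fin m) (Fin m) ℂ := fun j =>
    if j = jP then MP else if j = jQ then MQ else if j = jR then MR else if j = jY then MY else
      if j = j5 then MP + MY else 0 with hS
  set p : MatIdx m × MatIdx m → ℂ := fun q => S q.1 (ofLex q.2).1 (ofLex q.2).2 with hp
  -- all rows of `p` lie in `U`
  have hpU : ∀ j : MatIdx m, (fun i => p (j, i)) ∈ U := by
    intro j
    simp only [hp, hS]
    split_ifs
    · exact hP
    · exact hQ
    · exact hR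
    · exact hYU
    · simp only [Matrix.add_apply]
      exact U.add_mem hP hYU
    · simp only [Matrix.zero_apply]
      exact U.zero_mem
  -- `T` is symmetric
  have hTt : (fun j => (T j)ᵀ) = T := by
    funext j
    simp only [hT]
    split_ifs
    · exact Matrix.transpose_one
    · ext i j; fin_cases i <;> fin_cases j <;> rfl
    · ext i j; fin_cases i <;> fin_cases j <;> rfl
    · exact Matrix.transpose_one
    · exact Matrix.transpose_zero
  -- the numerical blow-up matrix at `p`
  have hTS : ∀ j, T j ⊗ₖ S j =
      if j = jP then (1 : Matrix (Fin 2) (Fin 2) ℂ) ⊗ₖ MP else if j = jQ then σx ⊗ₖ MQ else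
        if j = jR then σz ⊗ₖ MR else if j = jY then (1 : Matrix (Fin 2) (Fin 2) ℂ) ⊗ₖ MY else 0 := by
    intro j
    simp only [hT, hS]
    split_ifs <;> simp
  have hsum : ∑ j : MatIdx m, T j ⊗ₖ S j =
      (1 : Matrix (Fin 2) (Fin 2) ℂ) ⊗ₖ MP + σx ⊗ₖ MQ + σz ⊗ₖ MR + (1 : Matrix (Fin 2) (Fin 2) ℂ) ⊗ₖ MY := by
    simp only [hTS]
    exact frg_sum_ite_four hPQ hPR hPY hQR hQY hRY _ _ _ _
  have hmat : (Matrix.of fun a b : Fin 2 × Fin m => ∑ j : MatIdx m, T j a.1 b.1 * p (j, toLex (a.2, b.2))) =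
      ∑ j : MatIdx m, T j ⊗ₖ S j := by
    simp only [hp]
    exact frg_blowup_point_eq_sum_kronecker T S
  have hdet : MvPolynomial.eval p
      (Matrix.of fun a b : Fin 2 × Fin m =>
        ∑ j : MatIdx m, T j a.1 b.1 • MvPolynomial.X (R := ℂ) (j, toLex (a.2, b.2))).det ≠ 0 := by
    rw [frg_eval_det_blowup, hmat, hsum, hMP, hMQ, hMR, hMY, hσx, hσz, frg_det_level e Y]
    exact mul_ne_zero frg_core_det_ne_zero (pow_ne_zero _ hY)
  -- the witness and its properties
  set G : MvPolynomial (MatIdx m × MatIdx m) ℂ :=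
    (Matrix.of fun a b : Fin 2 × Fin m =>
        ∑ j : MatIdx m, T j a.1 b.1 • MvPolynomial.X (R := ℂ) (j, toLex (a.2, b.2))).det +
      (Matrix.of fun a b : Fin 2 × Fin m =>
        ∑ j : MatIdx m, (T j)ᵀ a.1 b.1 • MvPolynomial.X (R := ℂ) (j, toLex (a.2, b.2))).det with hG
  obtain ⟨hGh, hGsand, hGtr⟩ := stub_symBlowup_mem m 2 T
  have hGp : MvPolynomial.eval p G ≠ 0 := by
    have hTt' : ∀ j, (T j)ᵀ = T j := fun j => congr_fun hTt j
    simp only [hG, hTt', map_add]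
    intro h
    exact hdet (add_self_eq_zero.mp h)
  have hGs : ∀ M : Matrix (MatIdx m) (MatIdx m) ℂ, linSubst (MatIdx m) ℂ M (detFormLex ℂ m) = detFormLex ℂ m →
      MvPolynomial.aeval (R := ℂ) (fun q : MatIdx m × MatIdx m =>
        ∑ l : MatIdx m, M l q.2 • (X (q.1, l) : MvPolynomial (MatIdx m × MatIdx m) ℂ)) G = G := by
    have hmem := explicit_le_stabInv m (Submodule.mem_inf.mpr ⟨by
        simp only [Submodule.mem_iInf, LinearMap.mem_ker, LinearMap.sub_apply, sub_eq_zero,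
          AlgHom.toLinearMap_apply, LinearMap.id_coe, id_eq]
        exact hGsand, by
        simp only [LinearMap.mem_ker, LinearMap.sub_apply, sub_eq_zero, AlgHom.toLinearMap_apply,
          LinearMap.id_coe, id_eq]
        exact hGtr⟩)
    exact CutBitesAdjugate.mem_iInf_ker_sub_id_iff.mp hmem
  -- the fifth row slot: level-1 blow-up `G₁ = det X_{j5} + det X_{j5}` (1 × 1 data, symmetric)
  set T1 : MatIdx m → Matrix (Fin 1) (Fin 1) ℂ := fun j => if j = j5 then 1 else 0 with hT1
  set G₁ : MvPolynomial (MatIdx m × MatIdx m) ℂ :=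
    (Matrix.of fun a b : Fin 1 × Fin m =>
        ∑ j : MatIdx m, T1 j a.1 b.1 • MvPolynomial.X (R := ℂ) (j, toLex (a.2, b.2))).det +
      (Matrix.of fun a b : Fin 1 × Fin m =>
        ∑ j : MatIdx m, (T1 j)ᵀ a.1 b.1 • MvPolynomial.X (R := ℂ) (j, toLex (a.2, b.2))).det with hG₁
  obtain ⟨hG1h, hG1sand, hG1tr⟩ := stub_symBlowup_mem m 1 T1
  have hG1s : ∀ M : Matrix (MatIdx m) (MatIdx m) ℂ, linSubst (MatIdx m) ℂ M (detFormLex ℂ m) = detFormLex ℂ m →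
      MvPolynomial.aeval (R := ℂ) (fun q : MatIdx m × MatIdx m =>
        ∑ l : MatIdx m, M l q.2 • (X (q.1, l) : MvPolynomial (MatIdx m × MatIdx m) ℂ)) G₁ = G₁ := by
    have hmem := explicit_le_stabInv m (Submodule.mem_inf.mpr ⟨by
        simp only [Submodule.mem_iInf, LinearMap.mem_ker, LinearMap.sub_apply, sub_eq_zero,
          AlgHom.toLinearMap_apply, LinearMap.id_coe, id_eq]
        exact hG1sand, by
        simp only [LinearMap.mem_ker, LinearMap.sub_apply, sub_eq_zero, AlgHom.toLinearMap_apply,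
          LinearMap.id_coe, id_eq]
        exact hG1tr⟩)
    exact CutBitesAdjugate.mem_iInf_ker_sub_id_iff.mp hmem
  -- the witness `H = G ^ k * G₁`
  set H : MvPolynomial (MatIdx m × MatIdx m) ℂ := G ^ k * G₁ with hH
  have hHh : H.IsHomogeneous (m * (2 * k + 1)) := by
    have := (hGh.pow k).mul hG1h
    rwa [show m * 2 * k + m * 1 = m * (2 * k + 1) by ring] at this
  have hHs : ∀ M : Matrix (MatIdx m) (MatIdx m) ℂ, linSubst (MatIdx m) ℂ M (detFormLex ℂ m) = detFormLex ℂ m →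
      MvPolynomial.aeval (R := ℂ) (fun q : MatIdx m × MatIdx m =>
        ∑ l : MatIdx m, M l q.2 • (X (q.1, l) : MvPolynomial (MatIdx m × MatIdx m) ℂ)) H = H := by
    intro M hM
    rw [hH, map_mul, map_pow, hGs M hM, hG1s M hM]
  -- the line `p + s · E₂₂(fifth slot)` and the restriction map `ψ`
  set Q : Matrix (Fin m) (Fin m) ℂ := Matrix.reindex e e
    (Matrix.fromBlocks (!![0, 0, 0; 0, 0, 0; 0, 0, 1] : Matrix (Fin 3) (Fin 3) ℂ) 0 0 (0 : Matrix κ κ ℂ)) with hQdef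
  set nn : MatIdx m × MatIdx m → ℂ := fun v => if v.1 = j5 then Q (ofLex v.2).1 (ofLex v.2).2 else 0 with hnn
  set ψ : MvPolynomial (MatIdx m × MatIdx m) ℂ →ₐ[ℂ] ℂ[X] :=
    MvPolynomial.aeval (R := ℂ) (fun v : MatIdx m × MatIdx m => Polynomial.C (p v) + Polynomial.C (nn v) * Polynomial.X)
    with hψ
  -- `ψ` on the level-2 blow-ups: constant (the fifth slot carries `T = 0`)
  have hT5 : T j5 = 0 := by
    simp only [hT, if_neg h5P, if_neg h5Q, if_neg h5R, if_neg h5Y]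
  have hψdet : ∀ T' : MatIdx m → Matrix (Fin 2) (Fin 2) ℂ, T' j5 = 0 →
      ψ (Matrix.of fun a b : Fin 2 × Fin m =>
          ∑ j : MatIdx m, T' j a.1 b.1 • MvPolynomial.X (R := ℂ) (j, toLex (a.2, b.2))).det =
        Polynomial.C (MvPolynomial.eval p (Matrix.of fun a b : Fin 2 × Fin m =>
          ∑ j : MatIdx m, T' j a.1 b.1 • MvPolynomial.X (R := ℂ) (j, toLex (a.2, b.2))).det) := by
    intro T' hT'5
    have hent : ψ.mapMatrix (Matrix.of fun a b : Fin 2 × Fin m =>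
          ∑ j : MatIdx m, T' j a.1 b.1 • MvPolynomial.X (R := ℂ) (j, toLex (a.2, b.2))) =
        (Matrix.of fun a b : Fin 2 × Fin m => ∑ j : MatIdx m, T' j a.1 b.1 * p (j, toLex (a.2, b.2))).map
          Polynomial.C := by
      ext a b
      simp only [AlgHom.mapMatrix_apply, Matrix.map_apply, Matrix.of_apply, map_sum, map_smul, hψ,
        MvPolynomial.aeval_X, smul_add, Finset.sum_add_distrib]
      have hzero : ∑ j : MatIdx m, T' j a.1 b.1 • (Polynomial.C (nn (j, toLex (a.2, b.2))) * Polynomial.X) = 0 := by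
        refine Finset.sum_eq_zero fun j _ => ?_
        by_cases hj : j = j5
        · subst hj; simp [hT'5]
        · simp [hnn, hj]
      rw [hzero, add_zero]
      simp only [Polynomial.smul_C, smul_eq_mul]
    rw [AlgHom.map_det, hent, ← RingHom.mapMatrix_apply, ← RingHom.map_det, frg_eval_det_blowup]
  have hψG : ψ G = Polynomial.C (MvPolynomial.eval p G) := by
    have hTt5 : (fun j => (T j)ᵀ) j5 = 0 := by simp [hT5]
    simp only [hG, map_add]
    rw [hψdet T hT5, hψdet (fun j => (T j)ᵀ) hTt5]
  -- `ψ` on the level-1 blow-up of the fifth slot: `s · det Y`, twice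
  have hψdet1 : ψ (Matrix.of fun a b : Fin 1 × Fin m =>
        ∑ j : MatIdx m, T1 j a.1 b.1 • MvPolynomial.X (R := ℂ) (j, toLex (a.2, b.2))).det =
      Polynomial.X * Polynomial.C Y.det := by
    have hent : ψ.mapMatrix (Matrix.of fun a b : Fin 1 × Fin m =>
          ∑ j : MatIdx m, T1 j a.1 b.1 • MvPolynomial.X (R := ℂ) (j, toLex (a.2, b.2))) =
        Matrix.reindex (Equiv.uniqueProd (Fin m) (Fin 1)).symm (Equiv.uniqueProd (Fin m) (Fin 1)).symm
          ((MP + MY).map Polynomial.C + (Polynomial.X : ℂ[X]) • Q.map Polynomial.C) := by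
      ext a b
      have ha : a.1 = 0 := Subsingleton.elim _ _
      have hb : b.1 = 0 := Subsingleton.elim _ _
      simp only [AlgHom.mapMatrix_apply, Matrix.map_apply, Matrix.of_apply, Matrix.reindex_apply,
        Matrix.submatrix_apply, Equiv.symm_symm, Equiv.uniqueProd_apply, map_sum, map_smul]
      rw [Finset.sum_eq_single j5]
      · have h1 : T1 j5 a.1 b.1 = 1 := by
          rw [ha, hb]; simp only [hT1, if_pos rfl, Matrix.one_apply_eq]
        have h2 : p (j5, toLex (a.2, b.2)) = (MP + MY) a.2 b.2 := by
          show S j5 (ofLex (toLex (a.2, b.2))).1 (ofLex (toLex (a.2, b.2))).2 = _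
          rw [ofLex_toLex]
          simp [hS, if_neg h5P, if_neg h5Q, if_neg h5R, if_neg h5Y]
        have h3 : nn (j5, toLex (a.2, b.2)) = Q a.2 b.2 := by
          show (if (j5, toLex (a.2, b.2)).1 = j5 then Q (ofLex (j5, toLex (a.2, b.2)).2).1 (ofLex (j5, toLex (a.2, b.2)).2).2
            else 0) = _
          rw [if_pos rfl, ofLex_toLex]
        rw [h1, one_smul, hψ, MvPolynomial.aeval_X, h2, h3]
        simp only [Matrix.map_apply, Matrix.add_apply, Matrix.smul_apply, smul_eq_mul]
        ring
      · intro j _ hj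
        simp [hT1, hj]
      · intro h; exact absurd (Finset.mem_univ _) h
    rw [AlgHom.map_det, hent, Matrix.det_reindex_self, hMP, hMY, hQdef]
    rw [show (Matrix.reindex e e (Matrix.fromBlocks (!![0, 1, 0; -1, 0, 0; 0, 0, 0] : Matrix (Fin 3) (Fin 3) ℂ) 0 0
          (0 : Matrix κ κ ℂ)) + Matrix.reindex e e (Matrix.fromBlocks (0 : Matrix (Fin 3) (Fin 3) ℂ) 0 0 Y)) =
        Matrix.reindex e e (Matrix.fromBlocks (!![0, 1, 0; -1, 0, 0; 0, 0, 0] : Matrix (Fin 3) (Fin 3) ℂ) 0 0 Y) by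
      ext a b
      simp only [Matrix.add_apply, Matrix.reindex_apply, Matrix.submatrix_apply]
      cases e.symm a <;> cases e.symm b <;> simp [Matrix.fromBlocks]]
    exact frl_det_fifthRow e Y Polynomial.X
  have hψG₁ : ψ G₁ = Polynomial.X * Polynomial.C Y.det + Polynomial.X * Polynomial.C Y.det := by
    have hT1t : (fun j => (T1 j)ᵀ) = T1 := by
      funext j
      simp only [hT1]
      split_ifs
      · exact Matrix.transpose_one
      · exact Matrix.transpose_zero
    simp only [hG₁, map_add]
    rw [show (Matrix.of fun a b : Fin 1 × Fin m =>
        ∑ j : MatIdx m, (T1 j)ᵀ a.1 b.1 • MvPolynomial.X (R := ℂ) (j, toLex (a.2, b.2))) =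
        (Matrix.of fun a b : Fin 1 × Fin m =>
          ∑ j : MatIdx m, T1 j a.1 b.1 • MvPolynomial.X (R := ℂ) (j, toLex (a.2, b.2))) by
      simp only [show ∀ j, (T1 j)ᵀ = T1 j from fun j => congr_fun hT1t j], hψdet1]
  -- the `s¹`-coefficient of `ψ H` is `G(p)^k · 2 det Y ≠ 0`, so `H ∉ I(L_U)^2`
  have hcoeff : (ψ H).coeff 1 = (MvPolynomial.eval p G) ^ k * (Y.det + Y.det) := by
    rw [hH, map_mul, map_pow, hψG, hψG₁, ← Polynomial.C_pow, ← mul_add, ← Polynomial.C_add,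
      show Polynomial.C ((MvPolynomial.eval p G) ^ k) * (Polynomial.X * Polynomial.C (Y.det + Y.det)) =
        Polynomial.C ((MvPolynomial.eval p G) ^ k * (Y.det + Y.det)) * Polynomial.X by
          rw [Polynomial.C_mul]; ring,
      Polynomial.coeff_C_mul_X]
    simp
  have hH2 : H ∉ MvPolynomial.vanishingIdeal ℂ {q : MatIdx m × MatIdx m → ℂ |
      ∀ j : MatIdx m, (fun i => q (j, i)) ∈ U} ^ 2 := by
    intro hmem
    have h0 := frl_coeff_one_eq_zero_of_mem_sq nn (L := {q : MatIdx m × MatIdx m → ℂ |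
      ∀ j : MatIdx m, (fun i => q (j, i)) ∈ U}) hpU hmem
    rw [hcoeff] at h0
    exact mul_ne_zero (pow_ne_zero _ hGp) (add_self_eq_zero.not.mpr hY) h0
  -- order-2 extraction and the jet criterion at every `t ≥ 2`
  obtain ⟨lam, hcard, G', hG'h, hG's, hG'w, hG't⟩ :=
    hwExtraction_notMem_pow m (m * (2 * k + 1)) 2 U H hHh hHs hH2
  refine ⟨lam, hcard, fun t ht => ?_⟩
  have : Module.Finite ℂ ↥(MvPolynomial.homogeneousSubmodule (MatIdx m × MatIdx m) ℂ (m * (2 * k + 1))) :=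
    Module.Finite.iff_fg.mpr (MvPolynomial.homogeneousSubmodule_fg _ ℂ _)
  refine finrank_trunc_lt_of_notMem_pow ?_ (fun h => hG't (Ideal.pow_le_pow_right ht h))
  refine Submodule.mem_inf.mpr ⟨Submodule.mem_inf.mpr ⟨Submodule.mem_inf.mpr ⟨?_, ?_⟩, ?_⟩, ?_⟩
  · exact (mem_homogeneousSubmodule _ _).mpr hG'h
  · rw [pow_zero, Ideal.one_eq_top, Submodule.restrictScalars_top]
    exact Submodule.mem_top
  · exact CutBitesAdjugate.mem_iInf_ker_sub_id_iff.mpr hG's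
  · exact CutBitesAdjugate.mem_iInf_ker_sub_smul_iff.mpr hG'w

end

end Summit.ValiantsHypothesis.ValiantsHypothesis.Theorems.ValuativeFlip
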